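import Mathlib.NumberTheory.Padics.PadicVal.Basic
import Literature.Barriers.ABC.BakerMethodBoundsThreeRoutesProofs

/-!
# Stub `stub_twoLogOnePrime` of line `matveev-face-clearing` (crux stmt-ABC-1563): the WEAK form
# that linear forms in logarithms give today (calibration of the open Transfer C⁺)

Helper (`--supports stmt-ABC-1563`, registered sub-goal `stub_twoLogOnePrime_weak`) for the crux
`Summit.ABC.ABC.Theses.RibetTakahashiSplit.FewPrimeValuationProduct`, line `matveev-face-clearing`.

The line's Transfer C⁺ is the registered stub

  `stub_twoLogOnePrime : ∃ η > 0, ∀ ε > 0, ∃ A C, ∀ distinct odd primes ℓ p q, ∀ x y ≥ 1, ∀ k, ∀ σ = ±1,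
     ℓ^ε ≤ z → z ≤ C · ℓ^ε · (log p · log q · (k+1))^A · max(x,y)^{1-η}`,  `z := ord_ℓ(p^x + σ 2^k q^y)`,

an OPEN statement (replace the residue-field defect `|𝔽_ℓ^×| ≍ ℓ` of Yu's estimate by `ℓ^ε`: `BakerMethodBounds`
clause (i), smallest instance). This file proves, from the same input as the rest of the line (Matveev + Yu
over `ℚ` in Pasten's form, `Dioph.PastenApproximationBound K` = the statement of `stub_lflInput`), the WEAK form
that IS a theorem of the technique:

  `stub_twoLogOnePrime_weak : (∃ K ≥ 1, PastenApproximationBound K) → ∃ C, ∀ … ,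
     z ≤ C · ℓ · log p · log q · (1 + log (x+y+k+2) + log (log p + log q))`

— defect `ℓ` (not `ℓ^ε`) but only LOGARITHMIC dependence on the height `x+y+k` (not `max(x,y)^{1-η}`). Hence
C⁺ holds today exactly in the large-height regime `max(x,y)^{1-η} ≳ ℓ^{1-ε} · log(x+y+k)` (up to the
`log p log q` factors both sides carry), and the open content of C⁺ is the window
`ℓ^ε ≤ z`, `max(x,y) ≲ ℓ^{(1-ε)/(1-η)}`: many small exponents against one large prime `ℓ` of superconvergent
depth. (Exchange rate recorded by the planner: the bootstrap of `stub_decisivePrimeBootstrap` turns a defect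
`ℓ^θ` into `rad^{θ/η+o(1)}`, so no fixed `θ > 0`, in particular not this file's `θ = 1`, closes the crux.)

Proof: `n := p^x + σ 2^k q^y ≠ 0` sits in an abc triple on the primes `{2, p, q} ∪ primes(n)`:
`p^x + 2^k q^y = n` (`σ = 1`), `2^k q^y + n = p^x` or `p^x + |n| = 2^k q^y` (`σ = -1`); Pasten's `ℓ`-adic clause
for `ξ = ∓(2^k q^y)/p^x` (tree: `Pasten.padic_bound_c`, `Pasten.padic_bound_a`) reads
`z · log ℓ < Θ · (ℓ / log ℓ) · (log ℓ + log max(e, 2 log c))` with `Θ = theta K · · 0 = K^{ω+1} ∏_{r ∣ 2pq} log r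
≤ K⁴ log p log q` (`theta_zero_eq`) and `2 log c ≤ 2 log(p^x + 2^k q^y) ≤ e (x+y+k+2)(log p + log q)`.

References: Pasten, Invent. Math. 236 (2024), Thm 2.1; Yu, Forum Math. 19 (2007); Bugeaud–Laurent, JNT 61 (1996).
-/

-- `Summit.<Summit>.<Problem>` is the mandated summit-side namespace (CONVENTIONS §2); for the
-- single-conjunct summit `ABC` the duplicate `ABC.ABC` is deliberate.
set_option linter.dupNamespace false

noncomputable section

open Real Finset
open Literature.NumberTheory.DiophantineGeometry
open Literature.NumberTheory.DiophantineGeometry.Dioph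
open Literature.NumberTheory.DiophantineGeometry.Pasten
open Literature.Barriers.ABC

namespace Summit.ABC.ABC.Theorems.FewPrimeValuationProduct

/-! ## Elementary bookkeeping -/

/-- `1 ≤ log p` for `p ≥ 3` (since `e < 3`). [folklore] -/
private theorem one_le_log_of_three_le {p : ℕ} (hp : 3 ≤ p) : 1 ≤ Real.log p := by
  rw [← Real.log_exp 1]
  apply Real.log_le_log (Real.exp_pos 1)
  have h3 : (3 : ℝ) ≤ p := by exact_mod_cast hp
  have := Real.exp_one_lt_d9
  linarith

/-- An odd prime is at least `3`. [folklore] -/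
private theorem three_le_of_prime_ne_two {p : ℕ} (hp : p.Prime) (hp2 : p ≠ 2) : 3 ≤ p := by
  have := hp.two_le
  omega

/-- The prime factors of `p^x · (2^k · q^y)` lie in `{2, p, q}`. [folklore] -/
private theorem primeFactors_subset {p q x y k : ℕ} (hp : p.Prime) (hq : q.Prime) :
    (p ^ x * (2 ^ k * q ^ y)).primeFactors ⊆ {2, p, q} := by
  intro r hr
  obtain ⟨hr, hrdvd, -⟩ := Nat.mem_primeFactors.mp hr
  simp only [Finset.mem_insert, Finset.mem_singleton]
  rcases (Nat.Prime.dvd_mul hr).mp hrdvd with h | h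
  · exact Or.inr (Or.inl ((Nat.prime_dvd_prime_iff_eq hr hp).mp (hr.dvd_of_dvd_pow h)))
  · rcases (Nat.Prime.dvd_mul hr).mp h with h | h
    · exact Or.inl ((Nat.prime_dvd_prime_iff_eq hr Nat.prime_two).mp (hr.dvd_of_dvd_pow h))
    · exact Or.inr (Or.inr ((Nat.prime_dvd_prime_iff_eq hr hq).mp (hr.dvd_of_dvd_pow h)))

/-- **`Θ` at threshold `0` on the primes `{2, p, q}`:** for coprime non-zero `u, v` whose prime factors lie in
`{2, p, q}` (`p, q ≥ 3` distinct odd), `theta K u v 0 = K^{ω(uv)+1} ∏_{r ∣ uv} log r ≤ K⁴ · log p · log q`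
(`log 2 < 1 ≤ log p, log q`, `ω(uv) ≤ 3`, `K ≥ 1`). [folklore] -/
private theorem theta_zero_le {K : ℝ} (hK : 1 ≤ K) {u v p q : ℕ} (hu : u ≠ 0) (hv : v ≠ 0)
    (huv : u.Coprime v) (hsub : (u * v).primeFactors ⊆ {2, p, q}) (hp : 3 ≤ p) (hq : 3 ≤ q)
    (h2p : 2 ≠ p) (h2q : 2 ≠ q) (hpq : p ≠ q) :
    theta K u v 0 ≤ K ^ 4 * (Real.log p * Real.log q) := by
  rw [theta_zero_eq K hu hv huv]
  set T := (u * v).primeFactors with hT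
  -- the weight `f r = log r` for `r ≠ 2`, `f 2 = 1`
  set f : ℕ → ℝ := fun r => if r = 2 then 1 else Real.log r with hf
  have hcard3 : ({2, p, q} : Finset ℕ).card = 3 := by
    rw [Finset.card_insert_of_notMem (by simp [h2p, h2q]), Finset.card_insert_of_notMem (by simp [hpq]),
      Finset.card_singleton]
  have hcard : T.card ≤ 3 := hcard3 ▸ Finset.card_le_card hsub
  have hlogp : 1 ≤ Real.log p := one_le_log_of_three_le hp
  have hlogq : 1 ≤ Real.log q := one_le_log_of_three_le hq
  -- `∏_{r ∈ T} log r ≤ ∏_{r ∈ T} f r ≤ ∏_{r ∈ {2,p,q}} f r = log p · log q`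
  have h1 : ∏ r ∈ T, Real.log r ≤ ∏ r ∈ T, f r := by
    apply Finset.prod_le_prod
    · intro r hr
      exact Real.log_nonneg (by exact_mod_cast (Nat.prime_of_mem_primeFactors hr).one_lt.le)
    · intro r _
      simp only [hf]
      split_ifs with h2
      · subst h2
        have := Real.log_two_lt_d9
        simp only [Nat.cast_ofNat]
        linarith
      · exact le_rfl
  have hfge : ∀ r ∈ ({2, p, q} : Finset ℕ), 1 ≤ f r := by
    intro r hr
    simp only [Finset.mem_insert, Finset.mem_singleton] at hr
    simp only [hf]
    split_ifs with h2
    · exact le_rfl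
    · rcases hr with rfl | rfl | rfl
      · exact absurd rfl h2
      · exact hlogp
      · exact hlogq
  have hf0 : ∀ r ∈ T, 0 ≤ f r := fun r hr => zero_le_one.trans (hfge r (hsub hr))
  have h2 : ∏ r ∈ T, f r ≤ ∏ r ∈ ({2, p, q} : Finset ℕ), f r :=
    Finset.prod_le_prod_of_subset_of_one_le hsub hf0 fun r hr _ => hfge r hr
  have h3 : ∏ r ∈ ({2, p, q} : Finset ℕ), f r = Real.log p * Real.log q := by
    rw [Finset.prod_insert (by simp [h2p, h2q]), Finset.prod_insert (by simp [hpq]), Finset.prod_singleton]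
    simp only [hf, if_pos rfl, if_neg (Ne.symm h2p), if_neg (Ne.symm h2q), one_mul]
  have hprod : ∏ r ∈ T, Real.log r ≤ Real.log p * Real.log q := h1.trans (h3 ▸ h2)
  have hprod0 : 0 ≤ ∏ r ∈ T, Real.log r := Finset.prod_nonneg fun r hr =>
    Real.log_nonneg (by exact_mod_cast (Nat.prime_of_mem_primeFactors hr).one_lt.le)
  have hKpow : K ^ (T.card + 1) ≤ K ^ 4 := pow_le_pow_right₀ hK (by omega)
  have hK0 : 0 ≤ K ^ 4 := by positivity
  exact mul_le_mul hKpow hprod hprod0 hK0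

/-- **The analytic step.** From `z · log ℓ < Θ · ((ℓ / log ℓ) · (log ℓ + Y))` with `log ℓ ≥ 1`, `0 ≤ Θ ≤ Θ'`,
`0 ≤ Y ≤ Y'`, `1 ≤ Y'`: `z ≤ 2 · Θ' · ℓ · Y'`. [folklore] -/
private theorem depth_le_of_lt {z L Θ Θ' ℓ Y Y' : ℝ} (hL : 1 ≤ L) (hΘ0 : 0 ≤ Θ) (hΘ : Θ ≤ Θ')
    (hℓ : 0 ≤ ℓ) (hY0 : 0 ≤ Y) (hY : Y ≤ Y') (hY1 : 1 ≤ Y')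
    (h : z * L < Θ * (ℓ / L * (L + Y))) : z ≤ 2 * Θ' * ℓ * Y' := by
  have hL0 : 0 < L := lt_of_lt_of_le one_pos hL
  -- clear the denominator: `z L² < Θ ℓ (L + Y)`
  have h1 : z * L * L < Θ * ℓ * (L + Y) := by
    have : Θ * (ℓ / L * (L + Y)) = Θ * ℓ * (L + Y) / L := by
      field_simp
    rw [this, lt_div_iff₀ hL0] at h
    linarith
  -- `Θ ℓ (L + Y) ≤ Θ ℓ (1 + Y) L²`
  have h2 : Θ * ℓ * (L + Y) ≤ Θ * ℓ * (1 + Y) * (L * L) := by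
    have hΘℓ : 0 ≤ Θ * ℓ := mul_nonneg hΘ0 hℓ
    have hA : 0 ≤ L * (L - 1) := mul_nonneg hL0.le (by linarith)
    have hB : 0 ≤ Y * (L * L - 1) := mul_nonneg hY0 (by nlinarith)
    have hid : (1 + Y) * (L * L) - (L + Y) = L * (L - 1) + Y * (L * L - 1) := by ring
    have : L + Y ≤ (1 + Y) * (L * L) := by linarith
    calc Θ * ℓ * (L + Y) ≤ Θ * ℓ * ((1 + Y) * (L * L)) := mul_le_mul_of_nonneg_left this hΘℓ
      _ = Θ * ℓ * (1 + Y) * (L * L) := by ring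
  have h3 : z < Θ * ℓ * (1 + Y) := by
    have hLL : 0 < L * L := mul_pos hL0 hL0
    have : z * (L * L) < Θ * ℓ * (1 + Y) * (L * L) := by
      calc z * (L * L) = z * L * L := by ring
        _ < Θ * ℓ * (L + Y) := h1
        _ ≤ Θ * ℓ * (1 + Y) * (L * L) := h2
    exact lt_of_mul_lt_mul_right this hLL.le
  have h4 : Θ * ℓ * (1 + Y) ≤ 2 * Θ' * ℓ * Y' := by
    have h1Y : 1 + Y ≤ 2 * Y' := by linarith
    calc Θ * ℓ * (1 + Y) ≤ Θ' * ℓ * (2 * Y') :=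
          mul_le_mul (mul_le_mul_of_nonneg_right hΘ hℓ) h1Y (by linarith)
            (mul_nonneg (hΘ0.trans hΘ) hℓ)
      _ = 2 * Θ' * ℓ * Y' := by ring
  exact (h3.trans_le h4).le

/-- **Height bookkeeping.** For `P = p^x`, `Q = 2^k q^y` (`p, q ≥ 3`) and `1 ≤ c ≤ P + Q`:
`log max(e, 2 log c) ≤ 1 + log (x+y+k+2) + log (log p + log q)`. [folklore] -/
private theorem logmax_le {p q x y k c : ℕ} (hp : 3 ≤ p) (hq : 3 ≤ q) (hc : 1 ≤ c)
    (hcle : c ≤ p ^ x + 2 ^ k * q ^ y) :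
    Real.log (max (Real.exp 1) (2 * Real.log c)) ≤
      1 + Real.log ((x + y + k + 2 : ℕ) : ℝ) + Real.log (Real.log p + Real.log q) := by
  have hp0 : (0 : ℝ) < p := by exact_mod_cast (show 0 < p by omega)
  have hq0 : (0 : ℝ) < q := by exact_mod_cast (show 0 < q by omega)
  have hlogp : 1 ≤ Real.log p := one_le_log_of_three_le hp
  have hlogq : 1 ≤ Real.log q := one_le_log_of_three_le hq
  set Lpq : ℝ := Real.log p + Real.log q with hLpq
  have hL2 : 2 ≤ Lpq := by linarith
  have hlog2 : Real.log 2 ≤ Lpq := by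
    have := Real.log_two_lt_d9; linarith
  set S : ℝ := ((x + y + k + 2 : ℕ) : ℝ) with hS
  have hS2 : 2 ≤ S := by rw [hS]; exact_mod_cast (by omega : 2 ≤ x + y + k + 2)
  -- `log c ≤ log (P + Q) ≤ log (2 P Q) = (k+1) log 2 + x log p + y log q ≤ (x+y+k+1) Lpq`
  have hp1 : (1 : ℝ) ≤ p := by exact_mod_cast (show 1 ≤ p by omega)
  have hq1 : (1 : ℝ) ≤ q := by exact_mod_cast (show 1 ≤ q by omega)
  have hP1 : (1 : ℝ) ≤ (p : ℝ) ^ x := one_le_pow₀ hp1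
  have hQ1 : (1 : ℝ) ≤ (2 : ℝ) ^ k * (q : ℝ) ^ y :=
    one_le_mul_of_one_le_of_one_le (one_le_pow₀ (by norm_num)) (one_le_pow₀ hq1)
  have hc1 : (1 : ℝ) ≤ c := by exact_mod_cast hc
  have hcle' : (c : ℝ) ≤ (p : ℝ) ^ x + (2 : ℝ) ^ k * (q : ℝ) ^ y := by exact_mod_cast hcle
  have hsum : (p : ℝ) ^ x + (2 : ℝ) ^ k * (q : ℝ) ^ y ≤ 2 * ((p : ℝ) ^ x * ((2 : ℝ) ^ k * (q : ℝ) ^ y)) := by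
    nlinarith
  have hlogc : Real.log c ≤ (x + y + k + 1 : ℝ) * Lpq := by
    calc Real.log c ≤ Real.log (2 * ((p : ℝ) ^ x * ((2 : ℝ) ^ k * (q : ℝ) ^ y))) :=
          Real.log_le_log (by linarith) (hcle'.trans hsum)
      _ = Real.log 2 + (x * Real.log p + (k * Real.log 2 + y * Real.log q)) := by
          rw [Real.log_mul (by norm_num) (by positivity), Real.log_mul (by positivity) (by positivity),
            Real.log_mul (by positivity) (by positivity), Real.log_pow, Real.log_pow, Real.log_pow]
      _ ≤ Lpq + (x * Lpq + (k * Lpq + y * Lpq)) := by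
          gcongr
          · linarith
          · linarith
      _ = (x + y + k + 1 : ℝ) * Lpq := by ring
  -- `max(e, 2 log c) ≤ e · S · Lpq`
  have hSL : (1 : ℝ) ≤ S * Lpq := by nlinarith
  have hmax : max (Real.exp 1) (2 * Real.log c) ≤ Real.exp 1 * S * Lpq := by
    have he : Real.exp 1 ≤ Real.exp 1 * S * Lpq := by
      have := Real.exp_pos 1
      nlinarith
    have h2c : 2 * Real.log c ≤ Real.exp 1 * S * Lpq := by
      have he2 : (2 : ℝ) ≤ Real.exp 1 := by
        have := Real.add_one_le_exp (1 : ℝ); linarith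
      have hS' : (x + y + k + 1 : ℝ) ≤ S := by
        rw [hS]; push_cast; linarith
      calc 2 * Real.log c ≤ 2 * ((x + y + k + 1 : ℝ) * Lpq) := by linarith
        _ ≤ Real.exp 1 * (S * Lpq) := by
            apply mul_le_mul he2 _ (by positivity) (Real.exp_pos 1).le
            exact mul_le_mul_of_nonneg_right hS' (by linarith)
        _ = Real.exp 1 * S * Lpq := by ring
    exact max_le he h2c
  calc Real.log (max (Real.exp 1) (2 * Real.log c))
      ≤ Real.log (Real.exp 1 * S * Lpq) := Real.log_le_log (lt_max_of_lt_left (Real.exp_pos 1)) hmax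
    _ = 1 + Real.log S + Real.log Lpq := by
        rw [Real.log_mul (by positivity) (by linarith), Real.log_mul (Real.exp_pos 1).ne' (by linarith),
          Real.log_exp]

/-! ## The `ℓ`-adic clause on the triple spanned by `p^x` and `2^k q^y` -/

/-- **Yu's clause for `n = p^x + σ 2^k q^y`** (from `PastenApproximationBound K`): for distinct odd primes
`ℓ, p, q`, `x, y ≥ 1`, `σ = ±1`, writing `P = p^x`, `Q = 2^k q^y` and `m = |p^x + σ 2^k q^y| ∈ ℕ`:
`ν_ℓ(m) · log ℓ < Θ · ((ℓ / log ℓ) · (log ℓ + log max(e, 2 log c)))` for some `c ≤ P + Q`, `c ≥ 1`, with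
`Θ = theta K u v 0` for `{u, v} = {P, Q}` — unless `ℓ ∤ m`. Packaged as: either `ν_ℓ(m) = 0`, or the displayed
inequality with `Θ ≤ K⁴ log p log q` already inserted. [cite: Pasten2024, Theorem 2.1] -/
private theorem padic_clause {K : ℝ} (hK : 1 ≤ K) (hP : PastenApproximationBound K) {ℓ p q : ℕ}
    (hℓ : ℓ.Prime) (hp : p.Prime) (hq : q.Prime) (hp2 : p ≠ 2) (hq2 : q ≠ 2)
    (hpq : p ≠ q) {x y k : ℕ} (hx : 1 ≤ x) (hy : 1 ≤ y) {σ : ℤ} (hσ : σ = 1 ∨ σ = -1) :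
    ∃ c : ℕ, 1 ≤ c ∧ c ≤ p ^ x + 2 ^ k * q ^ y ∧
      ((padicValInt ℓ ((p : ℤ) ^ x + σ * 2 ^ k * (q : ℤ) ^ y) : ℝ) * Real.log ℓ <
        K ^ 4 * (Real.log p * Real.log q) *
          ((ℓ / Real.log ℓ) * (Real.log ℓ + Real.log (max (Real.exp 1) (2 * Real.log c)))) ∨
       padicValInt ℓ ((p : ℤ) ^ x + σ * 2 ^ k * (q : ℤ) ^ y) = 0) := by
  -- notation and basic facts
  set P : ℕ := p ^ x with hPdef
  set Q : ℕ := 2 ^ k * q ^ y with hQdef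
  have hp3 : 3 ≤ p := three_le_of_prime_ne_two hp hp2
  have hq3 : 3 ≤ q := three_le_of_prime_ne_two hq hq2
  have hP0 : 0 < P := by positivity
  have hQ0 : 0 < Q := by positivity
  have hP3 : 3 ≤ P := hp3.trans ((pow_one p).symm.le.trans (Nat.pow_le_pow_right hp.pos hx))
  have hQ3 : 3 ≤ Q := hq3.trans (((pow_one q).symm.le.trans (Nat.pow_le_pow_right hq.pos hy)).trans
    (Nat.le_mul_of_pos_left _ (by positivity)))
  have hcopPQ : P.Coprime Q := by
    rw [hPdef, hQdef]
    apply Nat.Coprime.mul_right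
    · exact Nat.Coprime.pow _ _ ((Nat.coprime_primes hp Nat.prime_two).mpr hp2)
    · exact Nat.Coprime.pow _ _ ((Nat.coprime_primes hp hq).mpr hpq)
  have hPQ : P ≠ Q := by
    intro h
    have h1 : P ∣ Q := h ▸ dvd_rfl
    have : P = 1 := Nat.Coprime.eq_one_of_dvd hcopPQ h1
    omega
  have hsubPQ : (P * Q).primeFactors ⊆ {2, p, q} := primeFactors_subset hp hq
  have hsubQP : (Q * P).primeFactors ⊆ {2, p, q} := by rw [mul_comm]; exact hsubPQ
  have hΘPQ : theta K P Q 0 ≤ K ^ 4 * (Real.log p * Real.log q) :=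
    theta_zero_le hK hP0.ne' hQ0.ne' hcopPQ hsubPQ hp3 hq3 (Ne.symm hp2) (Ne.symm hq2) hpq
  have hΘQP : theta K Q P 0 ≤ K ^ 4 * (Real.log p * Real.log q) :=
    theta_zero_le hK hQ0.ne' hP0.ne' hcopPQ.symm hsubQP hp3 hq3 (Ne.symm hp2) (Ne.symm hq2) hpq
  have hℓ1 : (1 : ℝ) ≤ ℓ := by exact_mod_cast hℓ.one_lt.le
  have hfac : 0 ≤ (ℓ : ℝ) / Real.log ℓ := div_nonneg (by linarith) (Real.log_nonneg hℓ1)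
  -- the generic upgrade `Θ ↦ K⁴ log p log q` inside the inequality
  have upgrade : ∀ {Θ t : ℝ} (c : ℕ), Θ ≤ K ^ 4 * (Real.log p * Real.log q) →
      t < Θ * ((ℓ / Real.log ℓ) * (Real.log ℓ + Real.log (max (Real.exp 1) (2 * Real.log c)))) →
      t < K ^ 4 * (Real.log p * Real.log q) *
        ((ℓ / Real.log ℓ) * (Real.log ℓ + Real.log (max (Real.exp 1) (2 * Real.log c)))) := by
    intro Θ t c hΘ ht
    refine ht.trans_le (mul_le_mul_of_nonneg_right hΘ (mul_nonneg hfac ?_))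
    have h1 : 0 ≤ Real.log ℓ := Real.log_nonneg hℓ1
    have h2 : 0 ≤ Real.log (max (Real.exp 1) (2 * Real.log c)) := by
      have := one_le_log_max_exp (2 * Real.log c); linarith
    linarith
  -- casts of `P`, `Q`
  have hPcast : ((P : ℕ) : ℤ) = (p : ℤ) ^ x := by rw [hPdef]; push_cast; ring
  have hQcast : ((Q : ℕ) : ℤ) = 2 ^ k * (q : ℤ) ^ y := by rw [hQdef]; push_cast; ring
  rcases hσ with rfl | rfl
  · -- `σ = 1`: the triple `P + Q = n`
    set c : ℕ := P + Q with hc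
    have hn : (p : ℤ) ^ x + 1 * 2 ^ k * (q : ℤ) ^ y = (c : ℤ) := by
      rw [hc, Nat.cast_add, hPcast, hQcast]; ring
    have habc : IsABCTriple P Q c := ⟨hP0, hQ0, rfl, hcopPQ⟩
    refine ⟨c, by omega, le_rfl, ?_⟩
    by_cases hℓc : ℓ ∣ c
    · left
      have h := padic_bound_c hK hP habc (by nlinarith) 0 hℓ hℓc
      rw [hn, padicValInt.of_nat, ← Nat.factorization_def c hℓ]
      exact upgrade c hΘPQ h
    · right
      rw [hn, padicValInt.of_nat]
      exact padicValNat.eq_zero_of_not_dvd hℓc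
  · -- `σ = -1`: `n = P - Q`
    rcases lt_or_gt_of_ne hPQ with hlt | hlt
    · -- `P < Q`: the triple `(Q - P) + P = Q`, `|n| = Q - P`
      set a : ℕ := Q - P with ha
      have ha0 : 0 < a := by omega
      have hn : (p : ℤ) ^ x + (-1) * 2 ^ k * (q : ℤ) ^ y = -(a : ℤ) := by
        rw [ha, Nat.cast_sub hlt.le, hPcast, hQcast]; ring
      have hcop : a.Coprime P := by
        rw [ha, Nat.Coprime, Nat.gcd_comm, Nat.gcd_sub_self_right hlt.le]
        exact hcopPQ
      have habc : IsABCTriple a P Q := ⟨ha0, hP0, by omega, hcop⟩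
      refine ⟨Q, by omega, by omega, ?_⟩
      have hval : padicValInt ℓ ((p : ℤ) ^ x + (-1) * 2 ^ k * (q : ℤ) ^ y) = padicValNat ℓ a := by
        rw [hn, padicValInt, Int.natAbs_neg, Int.natAbs_natCast]
      by_cases hℓa : ℓ ∣ a
      · left
        have h := padic_bound_a hK hP habc 0 hℓ hℓa
        rw [hval, ← Nat.factorization_def a hℓ]
        exact upgrade Q hΘPQ h
      · right
        rw [hval]
        exact padicValNat.eq_zero_of_not_dvd hℓa
    · -- `Q < P`: the triple `(P - Q) + Q = P`, `n = P - Q > 0`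
      set a : ℕ := P - Q with ha
      have ha0 : 0 < a := by omega
      have hn : (p : ℤ) ^ x + (-1) * 2 ^ k * (q : ℤ) ^ y = (a : ℤ) := by
        rw [ha, Nat.cast_sub hlt.le, hPcast, hQcast]; ring
      have hcop : a.Coprime Q := by
        rw [ha, Nat.Coprime, Nat.gcd_comm, Nat.gcd_sub_self_right hlt.le]
        exact hcopPQ.symm
      have habc : IsABCTriple a Q P := ⟨ha0, hQ0, by omega, hcop⟩
      refine ⟨P, by omega, by omega, ?_⟩
      have hval : padicValInt ℓ ((p : ℤ) ^ x + (-1) * 2 ^ k * (q : ℤ) ^ y) = padicValNat ℓ a := by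
        rw [hn, padicValInt.of_nat]
      by_cases hℓa : ℓ ∣ a
      · left
        have h := padic_bound_a hK hP habc 0 hℓ hℓa
        rw [hval, ← Nat.factorization_def a hℓ]
        exact upgrade P hΘQP h
      · right
        rw [hval]
        exact padicValNat.eq_zero_of_not_dvd hℓa

/-! ## The weak two-logarithm bound -/

/-- **`TwoLogOnePrime`, WEAK (Yu-defect) form — what the Baker method gives today** (registered sub-goal
`stub_twoLogOnePrime_weak` of crux stmt-ABC-1563, `--supports`). From Matveev + Yu over `ℚ` in Pasten's form
(`∃ K ≥ 1, PastenApproximationBound K`, the statement of `stub_lflInput`): there is `C` such that for all distinct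
odd primes `ℓ, p, q`, all `x, y ≥ 1`, `k ≥ 0` and `σ = ±1`,

  `ord_ℓ(p^x + σ 2^k q^y) ≤ C · ℓ · log p · log q · (1 + log (x+y+k+2) + log (log p + log q))`

(`C = 2 K⁴`). Compared with the open stub `stub_twoLogOnePrime` (`≤ C ℓ^ε (log p log q (k+1))^A max(x,y)^{1-η}`
in the regime `ord ≥ ℓ^ε`): the defect here is `ℓ` instead of `ℓ^ε`, the height enters only through
`log (x+y+k+2)` instead of `max(x,y)^{1-η}`; so the open stub HOLDS whenever
`max(x,y)^{1-η} · (log p log q (k+1))^{A-1} ≥ (2K⁴/C) · ℓ^{1-ε} · (1 + log(x+y+k+2) + log(log p + log q))`,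
and its open content is the complementary window (depth `≥ ℓ^ε` with `max(x,y) ≲ ℓ^{(1-ε)/(1-η)}`).
[cite: Pasten2024, Theorem 2.1] -/
theorem stub_twoLogOnePrime_weak :
    (∃ K : ℝ, 1 ≤ K ∧ Literature.NumberTheory.DiophantineGeometry.Dioph.PastenApproximationBound K) → ∃ C : ℝ, ∀ ℓ p q : ℕ, ℓ.Prime → p.Prime → q.Prime → ℓ ≠ 2 → p ≠ 2 → q ≠ 2 → ℓ ≠ p → ℓ ≠ q → p ≠ q → ∀ x y k : ℕ, 1 ≤ x → 1 ≤ y → ∀ σ : ℤ, (σ = 1 ∨ σ = -1) → (padicValInt ℓ ((p : ℤ) ^ x + σ * 2 ^ k * (q : ℤ) ^ y) : ℝ) ≤ C * (ℓ : ℝ) * (Real.log p * Real.log q) * (1 + Real.log ((x + y + k + 2 : ℕ) : ℝ) + Real.log (Real.log p + Real.log q)) := by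
  rintro ⟨K, hK, hP⟩
  refine ⟨2 * K ^ 4, ?_⟩
  intro ℓ p q hℓ hp hq hℓ2 hp2 hq2 _ _ hpq x y k hx hy σ hσ
  have hp3 : 3 ≤ p := three_le_of_prime_ne_two hp hp2
  have hq3 : 3 ≤ q := three_le_of_prime_ne_two hq hq2
  have hℓ3 : 3 ≤ ℓ := three_le_of_prime_ne_two hℓ hℓ2
  have hlogp : 1 ≤ Real.log p := one_le_log_of_three_le hp3
  have hlogq : 1 ≤ Real.log q := one_le_log_of_three_le hq3
  have hlogℓ : 1 ≤ Real.log ℓ := one_le_log_of_three_le hℓ3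
  have hℓ0 : (0 : ℝ) ≤ ℓ := Nat.cast_nonneg _
  set Yb : ℝ := 1 + Real.log ((x + y + k + 2 : ℕ) : ℝ) + Real.log (Real.log p + Real.log q) with hYb
  have hYb1 : 1 ≤ Yb := by
    have h1 : 0 ≤ Real.log ((x + y + k + 2 : ℕ) : ℝ) :=
      Real.log_nonneg (by exact_mod_cast (by omega : 1 ≤ x + y + k + 2))
    have h2 : 0 ≤ Real.log (Real.log p + Real.log q) := Real.log_nonneg (by linarith)
    linarith
  have hΘ'0 : 0 ≤ K ^ 4 * (Real.log p * Real.log q) := by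
    have : 0 ≤ K := zero_le_one.trans hK
    positivity
  -- the goal's right-hand side is `2 · Θ' · ℓ · Yb`
  have hRHS : 2 * K ^ 4 * (ℓ : ℝ) * (Real.log p * Real.log q) * Yb =
      2 * (K ^ 4 * (Real.log p * Real.log q)) * ℓ * Yb := by ring
  rw [hRHS]
  obtain ⟨c, hc1, hcle, h | h0⟩ := padic_clause hK hP hℓ hp hq hp2 hq2 hpq hx hy hσ
  · -- the `ℓ`-adic clause, then the analytic step
    have hY := logmax_le hp3 hq3 hc1 hcle
    have hY0 : 0 ≤ Real.log (max (Real.exp 1) (2 * Real.log c)) := by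
      have := one_le_log_max_exp (2 * Real.log c); linarith
    exact depth_le_of_lt hlogℓ hΘ'0 le_rfl hℓ0 hY0 hY hYb1 h
  · -- `ℓ ∤ n`: the depth is `0`
    rw [h0, Nat.cast_zero]
    have : 0 ≤ 2 * (K ^ 4 * (Real.log p * Real.log q)) * ℓ := by positivity
    exact mul_nonneg this (zero_le_one.trans hYb1)

end Summit.ABC.ABC.Theorems.FewPrimeValuationProduct

end
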